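import Literature.Geometry.DiscreteGeometry.KissingCertComp
import Literature.Geometry.DiscreteGeometry.KissingCertDataA
import Literature.Geometry.DiscreteGeometry.KissingCertDataB
import Literature.Geometry.DiscreteGeometry.KissingCertDataC

/-!
# Certificate for `k(4) < 25`: validation of the Gram expansions (block `r` chunk 3; `r_u`, `r_4`, `q`, `q_1`)

Kernel validation (`chunkOK`, `decide`) of the claimed expansions `zᵀ(LLᵀ)z` of the Gram blocks: the last
row chunk of `r`, and the blocks `r_u`, `r_4`, `q`, `q_1` in a single chunk each (the second and third
chunk checks are then trivial bookkeeping identities `R - R ≡ 0`).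

The statements are written directly in terms of the raw data of `KissingCertData{A,B,C}`
(decoded by `ofFlat`) and the checker of `KissingCertComp`; they are combined in
`KissingNumberFourProofs`.
-/

namespace Literature.Geometry.DiscreteGeometry

open PolyCert PolyCert.SPoly KissingFourCert

set_option maxHeartbeats 0 in
/-- Block `r`, rows `c1+c2 … 119`. [folklore] -/
theorem certP_r3 :
    chunkOK (GramBlk.mk certRZ certRL) (certRc1 + certRc2) ((GramBlk.mk certRZ certRL).z.length - (certRc1 + certRc2))
      (ofFlat certRD2f0 ++ ofFlat certRD2f1 ++ ofFlat certRD2f2 ++ ofFlat certRD2f3 ++ ofFlat certRD2f4 ++ ofFlat certRD2f5)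
      (ofFlat certRrf0 ++ ofFlat certRrf1 ++ ofFlat certRrf2 ++ ofFlat certRrf3 ++ ofFlat certRrf4 ++ ofFlat certRrf5) = true := by
  decide +kernel

set_option maxHeartbeats 0 in
/-- Block `r_u` (all rows). [folklore] -/
theorem certP_u1 :
    chunkOK (GramBlk.mk certRuZ certRuL) 0 (GramBlk.mk certRuZ certRuL).z.length []
      (ofFlat certRuPf0 ++ ofFlat certRuPf1 ++ ofFlat certRuPf2 ++ ofFlat certRuPf3) = true := by
  decide +kernel

/-- Block `r_u`, empty chunk. [folklore] -/
theorem certP_u2 :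
    chunkOK (GramBlk.mk certRuZ certRuL) (GramBlk.mk certRuZ certRuL).z.length 0
      (ofFlat certRuPf0 ++ ofFlat certRuPf1 ++ ofFlat certRuPf2 ++ ofFlat certRuPf3)
      (ofFlat certRuPf0 ++ ofFlat certRuPf1 ++ ofFlat certRuPf2 ++ ofFlat certRuPf3) = true := by
  decide +kernel

/-- Block `r_u`, empty chunk. [folklore] -/
theorem certP_u3 :
    chunkOK (GramBlk.mk certRuZ certRuL) ((GramBlk.mk certRuZ certRuL).z.length + 0)
      ((GramBlk.mk certRuZ certRuL).z.length - ((GramBlk.mk certRuZ certRuL).z.length + 0))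
      (ofFlat certRuPf0 ++ ofFlat certRuPf1 ++ ofFlat certRuPf2 ++ ofFlat certRuPf3)
      (ofFlat certRuPf0 ++ ofFlat certRuPf1 ++ ofFlat certRuPf2 ++ ofFlat certRuPf3) = true := by
  decide +kernel

set_option maxHeartbeats 0 in
/-- Block `r_4` (all rows). [folklore] -/
theorem certP_41 :
    chunkOK (GramBlk.mk certR4Z certR4L) 0 (GramBlk.mk certR4Z certR4L).z.length []
      (ofFlat certR4Pf0 ++ ofFlat certR4Pf1 ++ ofFlat certR4Pf2) = true := by
  decide +kernel

/-- Block `r_4`, empty chunk. [folklore] -/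
theorem certP_42 :
    chunkOK (GramBlk.mk certR4Z certR4L) (GramBlk.mk certR4Z certR4L).z.length 0
      (ofFlat certR4Pf0 ++ ofFlat certR4Pf1 ++ ofFlat certR4Pf2)
      (ofFlat certR4Pf0 ++ ofFlat certR4Pf1 ++ ofFlat certR4Pf2) = true := by
  decide +kernel

/-- Block `r_4`, empty chunk. [folklore] -/
theorem certP_43 :
    chunkOK (GramBlk.mk certR4Z certR4L) ((GramBlk.mk certR4Z certR4L).z.length + 0)
      ((GramBlk.mk certR4Z certR4L).z.length - ((GramBlk.mk certR4Z certR4L).z.length + 0))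
      (ofFlat certR4Pf0 ++ ofFlat certR4Pf1 ++ ofFlat certR4Pf2)
      (ofFlat certR4Pf0 ++ ofFlat certR4Pf1 ++ ofFlat certR4Pf2) = true := by
  decide +kernel

set_option maxHeartbeats 0 in
/-- Block `q` (all rows). [folklore] -/
theorem certP_q1 :
    chunkOK (GramBlk.mk certQZ certQL) 0 (GramBlk.mk certQZ certQL).z.length []
      (ofFlat certQqPf0) = true := by
  decide +kernel

/-- Block `q`, empty chunk. [folklore] -/
theorem certP_q2 :
    chunkOK (GramBlk.mk certQZ certQL) (GramBlk.mk certQZ certQL).z.length 0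
      (ofFlat certQqPf0)
      (ofFlat certQqPf0) = true := by
  decide +kernel

/-- Block `q`, empty chunk. [folklore] -/
theorem certP_q3 :
    chunkOK (GramBlk.mk certQZ certQL) ((GramBlk.mk certQZ certQL).z.length + 0)
      ((GramBlk.mk certQZ certQL).z.length - ((GramBlk.mk certQZ certQL).z.length + 0))
      (ofFlat certQqPf0)
      (ofFlat certQqPf0) = true := by
  decide +kernel

set_option maxHeartbeats 0 in
/-- Block `q_1` (all rows). [folklore] -/
theorem certP_q11 :
    chunkOK (GramBlk.mk certQ1Z certQ1L) 0 (GramBlk.mk certQ1Z certQ1L).z.length []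
      (ofFlat certQq1Pf0) = true := by
  decide +kernel

/-- Block `q_1`, empty chunk. [folklore] -/
theorem certP_q12 :
    chunkOK (GramBlk.mk certQ1Z certQ1L) (GramBlk.mk certQ1Z certQ1L).z.length 0
      (ofFlat certQq1Pf0)
      (ofFlat certQq1Pf0) = true := by
  decide +kernel

/-- Block `q_1`, empty chunk. [folklore] -/
theorem certP_q13 :
    chunkOK (GramBlk.mk certQ1Z certQ1L) ((GramBlk.mk certQ1Z certQ1L).z.length + 0)
      ((GramBlk.mk certQ1Z certQ1L).z.length - ((GramBlk.mk certQ1Z certQ1L).z.length + 0))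
      (ofFlat certQq1Pf0)
      (ofFlat certQq1Pf0) = true := by
  decide +kernel

end Literature.Geometry.DiscreteGeometry
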